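import Mathlib
import HarnessLib
import Literature.MathematicalPhysics.QuantumLattice.EuclideanAction

/-!
# Load-bearing hypotheses of two stubs of line `transverse-smearing-planar-threshold`
# (crux `PencilRigidity.ShellRigidity`, stmt-QuantumFields-11685) — refuter's negative lemmas

Drefute of the lead's reshaped skeleton `Cruxes/ShellRigidity/Lines/transverse-smearing-planar-threshold.lean`
(v2, 7 registered stubs). No stub could be broken; this file records, as kernel-checked negative lemmas, two
hypotheses that any proof MUST use.

* `coneOfDiscSections_false_without_uniform_bound` — in `stub_coneOfDiscSections` (verbatim the sibling stub
  `stub_cone_of_discSections` of crux `PlanarSpectralCone`, stmt-QuantumFields-9664) the constant `M` bounding the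
  holomorphic disc sections `f_t` on `|z| < t` is quantified BEFORE the radius `t`. With `∀ t, ∃ M` instead
  (everything else verbatim) the statement is false: the Dirac mass at the space-like momentum `e₁ = (0,1,0,0)` has
  disc sections `f_t(z) = e^{iz}`, entire, bounded by `e^t` on `|z| < t`, while `μ {p₀ < |p₁|} = 1`. So a proof must
  exploit the `t`-uniformity (exponential moments `∫ e^{Y(|p₁| - p₀) - s p₀} dμ ≤ 2M` for ALL `Y ≥ 0`).
* `axisLaplace_false_without_parity` — in `stub_axisLaplace` the spatial-parity hypothesis `hP`
  (`K(x₀, -x⃗) = K(x₀, x⃗)`) cannot be dropped: `K x = e^{-|x₀|} (1 + ½ sin x₁)` is continuous, bounded, even in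
  `x₀`, and pointwise OS-positive across `x₀ = 0` for REAL coefficients (the `sin` part of the Gram matrix is
  antisymmetric, so `∑ cᵢcⱼK(θxᵢ - xⱼ) = (∑ cᵢe^{-xᵢ⁰})² ≥ 0`), yet it has no Laplace–Fourier representation:
  such a representation makes `a ↦ K(e₀ + a)` the Fourier transform of a positive measure, in particular even in `a`,
  and `K(e₀ + (π/2)e₁) = (3/2)e^{-1} ≠ (1/2)e^{-1} = K(e₀ - (π/2)e₁)`. (Real PSD of a non-symmetric kernel is not
  complex PSD: `hP` is what makes the Gram matrices symmetric.)
-/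

noncomputable section

namespace Summit.QuantumFields.YangMills.Theorems.ShellRigidity.Negative

open MeasureTheory Complex
open scoped InnerProductSpace ComplexConjugate
open Literature.MathematicalPhysics.QuantumLattice

/-- **The uniform bound is load-bearing in `stub_coneOfDiscSections`**: with `M` allowed to depend on the
radius `t`, the statement is false (witness: the Dirac mass at `e₁`, disc sections `z ↦ e^{iz}`). [folklore] -/
theorem coneOfDiscSections_false_without_uniform_bound :
    ¬ (∀ (μ : Measure (EuclideanSpace ℝ (Fin 4))) [IsFiniteMeasure μ], μ {p | p 0 < 0} = 0 →
        (∀ t : ℝ, 0 < t → ∃ M : ℝ, ∃ f : ℂ → ℂ,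
          DifferentiableOn ℂ f (Metric.ball 0 t) ∧
            (∀ z ∈ Metric.ball (0 : ℂ) t, ‖f z‖ ≤ M) ∧
              ∀ b : ℝ, |b| < t →
                f b = ∫ p, Complex.exp ((((-(t * p 0) : ℝ)) : ℂ) + ((b * p 1 : ℝ) : ℂ) * Complex.I) ∂μ) →
        μ {p | p 0 < |p 1|} = 0) := by
  intro h
  set v : EuclideanSpace ℝ (Fin 4) := EuclideanSpace.single 1 1 with hv
  have hv0 : v 0 = 0 := by simp [hv]
  have hv1 : v 1 = 1 := by simp [hv]
  have hE : (Measure.dirac v) {p : EuclideanSpace ℝ (Fin 4) | p 0 < 0} = 0 := by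
    rw [Measure.dirac_apply]
    simp [hv0]
  have hdisc : ∀ t : ℝ, 0 < t → ∃ M : ℝ, ∃ f : ℂ → ℂ,
      DifferentiableOn ℂ f (Metric.ball 0 t) ∧
        (∀ z ∈ Metric.ball (0 : ℂ) t, ‖f z‖ ≤ M) ∧
          ∀ b : ℝ, |b| < t →
            f b = ∫ p, Complex.exp ((((-(t * p 0) : ℝ)) : ℂ) + ((b * p 1 : ℝ) : ℂ) * Complex.I)
              ∂(Measure.dirac v) := by
    intro t _ht
    refine ⟨Real.exp t, fun z => Complex.exp (z * Complex.I), ?_, ?_, ?_⟩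
    · exact ((differentiable_id.mul_const _).cexp).differentiableOn
    · intro z hz
      rw [Complex.norm_exp]
      apply Real.exp_le_exp.2
      have h1 : (z * Complex.I).re = -z.im := by simp [Complex.mul_re]
      rw [h1]
      have h2 : |z.im| ≤ ‖z‖ := Complex.abs_im_le_norm z
      have h3 : ‖z‖ < t := by simpa using hz
      linarith [neg_abs_le z.im]
    · intro b _hb
      rw [integral_dirac]
      simp [hv0, hv1]
  have key := h (Measure.dirac v) hE hdisc
  rw [Measure.dirac_apply] at key
  have hmem : v ∈ {p : EuclideanSpace ℝ (Fin 4) | p 0 < |p 1|} := by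
    simp [hv0, hv1]
  simp [Set.indicator_of_mem hmem] at key

/-- **Spatial parity is load-bearing in `stub_axisLaplace`**: without `hP` the statement is false (witness
`K x = e^{-|x₀|}(1 + ½ sin x₁)`: continuous, bounded, time-even, pointwise OS-positive across `x₀ = 0` for real
coefficients, not spatially even — hence not a Laplace–Fourier transform of a positive measure). [folklore] -/
theorem axisLaplace_false_without_parity :
    ¬ (∀ (K : EuclideanSpace ℝ (Fin 4) → ℝ), ContinuousOn K {x | x ≠ 0} →
        (∀ ε : ℝ, 0 < ε → ∃ B : ℝ, ∀ x : EuclideanSpace ℝ (Fin 4), ε ≤ |x 0| → |K x| ≤ B) →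
        (∀ x y : EuclideanSpace ℝ (Fin 4), y 0 = -x 0 → y 1 = x 1 → y 2 = x 2 → y 3 = x 3 → K y = K x) →
        (∀ (m : ℕ) (x : Fin m → EuclideanSpace ℝ (Fin 4)) (c : Fin m → ℝ), (∀ i, 0 < x i 0) →
          0 ≤ ∑ i, ∑ j, c i * c j * K (timeReflection 4 (x i) - x j)) →
        ∀ ε : ℝ, 0 < ε → ∃ μ : Measure (EuclideanSpace ℝ (Fin 4)), IsFiniteMeasure μ ∧ μ {p | p 0 < 0} = 0 ∧
          ∀ t : ℝ, 0 ≤ t → ∀ a : EuclideanSpace ℝ (Fin 4), a 0 = 0 →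
            ((K (EuclideanSpace.single 0 (ε + t) + a) : ℝ) : ℂ) =
              ∫ p, cexp (((-(t * p 0) : ℝ) : ℂ) + ((⟪a, p⟫_ℝ : ℝ) : ℂ) * I) ∂μ) := by
  intro h
  set K : EuclideanSpace ℝ (Fin 4) → ℝ := fun x => Real.exp (-|x 0|) * (1 + Real.sin (x 1) / 2) with hK
  have hcont : Continuous K := by
    have h0 : Continuous fun x : EuclideanSpace ℝ (Fin 4) => x 0 := PiLp.continuous_apply 2 _ 0
    have h1 : Continuous fun x : EuclideanSpace ℝ (Fin 4) => x 1 := PiLp.continuous_apply 2 _ 1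
    simp only [hK]
    fun_prop
  have hc : ContinuousOn K {x | x ≠ 0} := hcont.continuousOn
  have hbdd : ∀ ε : ℝ, 0 < ε → ∃ B : ℝ, ∀ x : EuclideanSpace ℝ (Fin 4), ε ≤ |x 0| → |K x| ≤ B := by
    intro ε _
    refine ⟨2, fun x _ => ?_⟩
    simp only [hK]
    rw [abs_mul, Real.abs_exp]
    have h1 : Real.exp (-|x 0|) ≤ 1 := Real.exp_le_one_iff.mpr (neg_nonpos.mpr (abs_nonneg _))
    have h2 : |1 + Real.sin (x 1) / 2| ≤ 2 := by
      rw [abs_le]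
      constructor <;> linarith [Real.sin_le_one (x 1), Real.neg_one_le_sin (x 1)]
    calc Real.exp (-|x 0|) * |1 + Real.sin (x 1) / 2| ≤ 1 * 2 :=
          mul_le_mul h1 h2 (abs_nonneg _) zero_le_one
      _ = 2 := one_mul 2
  have hθ : ∀ x y : EuclideanSpace ℝ (Fin 4), y 0 = -x 0 → y 1 = x 1 → y 2 = x 2 → y 3 = x 3 → K y = K x := by
    intro x y h0 h1 _ _
    simp only [hK, h0, h1, abs_neg]
  have hax : ∀ (m : ℕ) (x : Fin m → EuclideanSpace ℝ (Fin 4)) (c : Fin m → ℝ), (∀ i, 0 < x i 0) →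
      0 ≤ ∑ i, ∑ j, c i * c j * K (timeReflection 4 (x i) - x j) := by
    intro m x c hx
    have hval : ∀ i j, K (timeReflection 4 (x i) - x j) =
        Real.exp (-(x i 0)) * Real.exp (-(x j 0)) * (1 + Real.sin (x i 1 - x j 1) / 2) := by
      intro i j
      simp only [hK, PiLp.sub_apply, timeReflection_apply]
      simp only [Fin.isValue, ↓reduceIte, one_ne_zero]
      have hpos : 0 < x i 0 + x j 0 := add_pos (hx i) (hx j)
      rw [show -x i 0 - x j 0 = -(x i 0 + x j 0) by ring, abs_neg, abs_of_pos hpos, neg_add, Real.exp_add]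
    set u : Fin m → ℝ := fun i => c i * Real.exp (-(x i 0)) with hu
    have hA : ∑ i, ∑ j, u i * u j * Real.sin (x i 1 - x j 1) = 0 := by
      have hanti : ∑ i, ∑ j, u i * u j * Real.sin (x i 1 - x j 1) =
          -(∑ i, ∑ j, u i * u j * Real.sin (x i 1 - x j 1)) := by
        conv_rhs => rw [Finset.sum_comm]
        rw [← Finset.sum_neg_distrib]
        refine Finset.sum_congr rfl fun i _ => ?_
        rw [← Finset.sum_neg_distrib]
        refine Finset.sum_congr rfl fun j _ => ?_
        rw [show x j 1 - x i 1 = -(x i 1 - x j 1) by ring, Real.sin_neg]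
        ring
      linarith
    have hsplit : ∑ i, ∑ j, c i * c j * K (timeReflection 4 (x i) - x j) =
        (∑ i, u i) * (∑ j, u j) + (∑ i, ∑ j, u i * u j * Real.sin (x i 1 - x j 1)) / 2 := by
      rw [Finset.sum_mul_sum, Finset.sum_div, ← Finset.sum_add_distrib]
      refine Finset.sum_congr rfl fun i _ => ?_
      rw [Finset.sum_div, ← Finset.sum_add_distrib]
      refine Finset.sum_congr rfl fun j _ => ?_
      rw [hval i j]
      simp only [hu]
      ring
    rw [hsplit, hA, zero_div, add_zero]
    exact mul_self_nonneg _
  obtain ⟨μ, _, -, hrep⟩ := h K hc hbdd hθ hax 1 one_pos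
  set a : EuclideanSpace ℝ (Fin 4) := EuclideanSpace.single 1 (Real.pi / 2) with ha
  have ha0 : a 0 = 0 := by simp [ha]
  have hna0 : (-a) 0 = 0 := by simp [ha]
  have h1 := hrep 0 le_rfl a ha0
  have h2 := hrep 0 le_rfl (-a) hna0
  -- complex conjugation maps the representation at `a` to the representation at `-a`
  have hconj : conj (∫ p, cexp (((-(0 * p 0) : ℝ) : ℂ) + ((⟪a, p⟫_ℝ : ℝ) : ℂ) * I) ∂μ) =
      ∫ p, cexp (((-(0 * p 0) : ℝ) : ℂ) + ((⟪-a, p⟫_ℝ : ℝ) : ℂ) * I) ∂μ := by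
    rw [← integral_conj]
    refine integral_congr_ae (Filter.Eventually.of_forall fun p => ?_)
    simp only []
    rw [← Complex.exp_conj, map_add, map_mul, Complex.conj_ofReal, Complex.conj_ofReal, Complex.conj_I,
      inner_neg_left]
    push_cast
    ring_nf
  have hEq : K (EuclideanSpace.single 0 (1 + 0) + a) = K (EuclideanSpace.single 0 (1 + 0) + -a) := by
    have := congrArg conj h1
    rw [Complex.conj_ofReal, hconj, ← h2] at this
    exact_mod_cast this
  have hv1 : (EuclideanSpace.single 0 (1 + 0) + a : EuclideanSpace ℝ (Fin 4)) 1 = Real.pi / 2 := by simp [ha]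
  have hv1' : (EuclideanSpace.single 0 (1 + 0) + -a : EuclideanSpace ℝ (Fin 4)) 1 = -(Real.pi / 2) := by
    simp [ha]
  have hv0 : (EuclideanSpace.single 0 (1 + 0) + a : EuclideanSpace ℝ (Fin 4)) 0 = 1 := by simp [ha]
  have hv0' : (EuclideanSpace.single 0 (1 + 0) + -a : EuclideanSpace ℝ (Fin 4)) 0 = 1 := by simp [ha]
  simp only [hK, hv1, hv1', hv0, hv0', Real.sin_pi_div_two, Real.sin_neg] at hEq
  have hpos : 0 < Real.exp (-|(1 : ℝ)|) := Real.exp_pos _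
  have hdiff : Real.exp (-|(1 : ℝ)|) * (1 + 1 / 2) - Real.exp (-|(1 : ℝ)|) * (1 + -1 / 2) =
      Real.exp (-|(1 : ℝ)|) := by ring
  rw [hEq, sub_self] at hdiff
  linarith

end Summit.QuantumFields.YangMills.Theorems.ShellRigidity.Negative

end
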